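import Summits.ResolutionOfSingularities.ResolutionOfSingularities.Theorems.FoliationDescentFolLUStubSaturation
import Literature.AlgebraicGeometry.Resolution.LocalBlowup
import HarnessLib

/-!
# Crux `FolLU` (stmt-ResolutionOfSingularities-17081), line `birth` — the route's centre clause vs. `locAtCentre`

Route `ResolutionOfSingularities/FoliationDescent`. The route file `Theses/FoliationDescent.lean`
encodes the local ring of a model `S ≤ O` at the centre of the valuation ring `O` elementwise:
`x ∈ S_c :⟺ ∃ a b, a ∈ S ∧ b ∈ S ∧ b ≠ 0 ∧ b⁻¹ ∈ O ∧ x = a / b`. The tree's valuative framework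
(`Literature/AlgebraicGeometry/Resolution/LocalBlowup.lean`, `QuadraticTransforms*.lean`,
`LipmanValuativeQuadraticSequence*.lean`) uses the subring `locAtCentre S.toSubring O` =
`{y / z | y z ∈ S, O.valuation z = 1}`. This file proves that the two agree when `S ≤ O`
(`stub_inCtr_iff_mem_locAtCentre`), so that quadratic transforms, Abhyankar's factorization and
the regularity of local blow-ups become available to every attack on the crux in its own
vocabulary. Lead prover of line `birth`, 2026-08-17. Definition-free; kernel-only.
-/

set_option linter.dupNamespace false -- mandated namespace of this single-conjunct summit

namespace Summit.ResolutionOfSingularities.ResolutionOfSingularities.Theorems.FolLU.CentreBridge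

open Literature.AlgebraicGeometry.Resolution

/-- For `b ∈ O`: `O.valuation b = 1` iff `b ≠ 0 ∧ b⁻¹ ∈ O` (both say that `b` is a unit of `O`).
[folklore] -/
theorem valuation_eq_one_iff_inv_mem {K : Type*} [Field K] (O : ValuationSubring K) {b : K}
    (hb : b ∈ O) : O.valuation b = 1 ↔ (b ≠ 0 ∧ b⁻¹ ∈ O) := by
  rw [← not_mem_maximalIdeal_iff_inv_mem O ⟨b, hb⟩, ← (O.valuation_eq_one_iff ⟨b, hb⟩)]
  constructor
  · intro h hm
    exact (IsLocalRing.mem_maximalIdeal _ |>.mp hm) h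
  · intro h
    by_contra hu
    exact h ((IsLocalRing.mem_maximalIdeal _).mpr hu)

end Summit.ResolutionOfSingularities.ResolutionOfSingularities.Theorems.FolLU.CentreBridge

namespace Summit.ResolutionOfSingularities.ResolutionOfSingularities.Theorems.FolLU

open Literature.AlgebraicGeometry.Resolution

/-- **The route's centre clause is membership in `locAtCentre`.** For a subalgebra `S ≤ O` of `K`
and `x ∈ K`: `x = a / b` with `a b ∈ S`, `b ≠ 0`, `b⁻¹ ∈ O` iff
`x ∈ locAtCentre S.toSubring O` (`= {y/z | y z ∈ S, O.valuation z = 1}`,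
`Literature/AlgebraicGeometry/Resolution/LocalBlowup.lean`). [folklore] -/
theorem stub_inCtr_iff_mem_locAtCentre :
    ∀ (k K : Type) [Field k] [Field K] [Algebra k K] (O : ValuationSubring K) (S : Subalgebra k K),
    S.toSubring ≤ O.toSubring → ∀ x : K,
    ((∃ a b : K, a ∈ S ∧ b ∈ S ∧ b ≠ 0 ∧ b⁻¹ ∈ O ∧ x = a / b) ↔
      x ∈ Literature.AlgebraicGeometry.Resolution.locAtCentre S.toSubring O) := by
  intro k K _ _ _ O S hS x
  rw [mem_locAtCentre_iff]
  constructor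
  · rintro ⟨a, b, ha, hb, hb0, hbi, rfl⟩
    have hbO : b ∈ O := hS (show b ∈ S.toSubring from hb)
    exact ⟨a, ha, b, hb, (CentreBridge.valuation_eq_one_iff_inv_mem O hbO).mpr ⟨hb0, hbi⟩, rfl⟩
  · rintro ⟨a, ha, b, hb, hv, rfl⟩
    have hbO : b ∈ O := hS (show b ∈ S.toSubring from hb)
    obtain ⟨hb0, hbi⟩ := (CentreBridge.valuation_eq_one_iff_inv_mem O hbO).mp hv
    exact ⟨a, b, ha, hb, hb0, hbi, rfl⟩

end Summit.ResolutionOfSingularities.ResolutionOfSingularities.Theorems.FolLU
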